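import Mathlib
import Summits.Ventures.PercRepro2.HCov
import Summits.Ventures.PercRepro2.GcSkelRules
import Summits.Ventures.PercRepro2.GcSkelReductionT
import Summits.Ventures.PercRepro2.GcSkelReductionMin
import Summits.Ventures.PercRepro2.GcSkelReductionO
import Summits.Ventures.PercRepro2.GcSkelReductionOB
import Summits.Ventures.PercRepro2.GcSkelReductionMinOB
import Summits.Ventures.PercRepro2.GcSkelReductionH
import Summits.Ventures.PercRepro2.GcSkelReductionMinH
import Summits.Ventures.PercRepro2.GcSkelReductionActive
import Summits.Ventures.PercRepro2.GcSkelReductionBounded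
import Summits.Ventures.PercRepro2.GcTransport
import Summits.Ventures.PercRepro2.A3RootEdgeAll
import Summits.Ventures.PercRepro2.GcRootPair
import Summits.Ventures.PercRepro2.GcInterior
import Summits.Ventures.PercRepro2.GcRational

/-!
# The residual with no edge among the roots (blind cell PercRepro2, typer-1 g56)

Two closures of (HCOV) delete an edge between two of the roots `a₁, a₂, a₃` at every weight:
p5 g13's root-edge closure at `a₃` (`RootEdge.HCov_of_update_zero_of_isRootEdge`, A3RootEdgeAll:
`e = {a₃, a₁}` or `{a₃, a₂}`) and the root-pair scaling `Gc p = (1 − p e)³ · Gc (p[e ↦ 0])` of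
GcRootPair.lean (`e = {a₁, a₂}`). With p1 g11's pinned-closed transport (`Gc_update_zero_eq_loop`:
`Gc(p[e ↦ 0])` is `Gc` of the graph with `e` re-routed to a loop) each is one more REDUCTION of
the weighted calculus, lowering `nonLoopCard` (**`HCov_of_loop_of_isRootEdge`**,
`RootPair.HCov_of_loop_of_rootPair`). They fold into the class of record through the size-bounded
residual theorem of `GcSkelReductionBounded.lean`:

* **`IsRootsEdge`** (`e` joins two of `a₁, a₂, a₃`), **`NoRootsEdge`**, **`WReducedMinHAZ`** :=
  `WReducedMinHA` ∧ `NoRootsEdge` (29 clauses: the three roots pairwise non-adjacent), the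
  closures `HCovWRedMinHAZ_le` / `HCovWRedMinHAZ_all` / `HCovWRedMinHAZ_int_all`;
* **`HCov_of_HCovWRedMinHAZ_le`** — strong induction on `nonLoopCard` over all graphs: at each size
  the bounded residual theorem is fed the `WReducedT` instances, on which an edge among the roots
  is looped (one non-loop edge fewer — the induction hypothesis), the star / hub / active-vertex
  class theorems apply, or the instance is in `WReducedMinHAZ`;
* **`HCov_all_iff_HCovWRedMinHAZ_all`**, **`HCov_all_iff_HCovWRedMinHAZ_int_all`**,
  **`HCov_all_real_iff_HCovWRedMinHAZ_int_all_rat`** — THE STATEMENT OF RECORD: the crux over `ℝ`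
  is (HCOV) on the class of record in which no edge joins two roots, at rational interior
  weights; **`roots_nonadjacent_of_wredMinHAZ`** — there `a₁ ≁ a₂`, `a₁ ≁ a₃`, `a₂ ≁ a₃`.

Every further reduction lowering `nonLoopCard` folds by the pattern of `HCov_of_HCovWRedMinHAZ_le`
(no induction body to copy); every further class theorem by one more `by_cases`.
-/

namespace Summit.Ventures.PercRepro2

open CovForm RECM

namespace WRed

/-! ## The root edge at `a₃` is a reduction -/

section RootEdgeStep

variable {V : Type*} {E : Type*} [Fintype V] [DecidableEq V] [Fintype E] [DecidableEq E]

omit [Fintype V] [DecidableEq V] [Fintype E] [DecidableEq E] in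
/-- A root edge at `a₃` is a non-loop edge. -/
lemma not_isDiag_of_isRootEdge {ends : E → Sym2 V} {a₁ a₂ a₃ : V} {e : E} (h13 : a₁ ≠ a₃)
    (h23 : a₂ ≠ a₃) (he : RootEdge.IsRootEdge ends a₁ a₂ a₃ e) : ¬ (ends e).IsDiag := by
  rcases he with h | h | h | h <;> rw [h, Sym2.mk_isDiag_iff]
  · exact h13
  · exact h13.symm
  · exact h23
  · exact h23.symm

variable {R : Type*} [Field R] [LinearOrder R] [IsStrictOrderedRing R]

/-- **A root edge at `a₃` is deleted**: (HCOV) on the graph with `e` (joining `a₃` to a root)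
re-routed to a loop at `a₃` gives (HCOV) on `G` — p5 g13's root-edge closure at `p[e ↦ 0]` and the
pinned-closed transport `Gc_update_zero_eq_loop`. -/
theorem HCov_of_loop_of_isRootEdge {ends : E → Sym2 V} {o a₁ a₂ a₃ b : V} {e : E}
    (he : RootEdge.IsRootEdge ends a₁ a₂ a₃ e) (p : E → R) (hp : IsProbVec p)
    (h : HCov p (Function.update ends e s(a₃, a₃)) o a₁ a₂ a₃ b) : HCov p ends o a₁ a₂ a₃ b := by
  refine RootEdge.HCov_of_update_zero_of_isRootEdge p hp ends o a₁ a₂ a₃ b e he ?_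
  unfold HCov at h ⊢
  rw [Gc_update_zero_eq_loop p ends e a₃ o a₁ a₂ a₃ b]
  exact h

end RootEdgeStep

/-! ## The class -/

section ClassZ

variable {V : Type*} {E : Type*} [Fintype E] [DecidableEq E] [DecidableEq V]

/-- **An edge among the roots**: `e` joins two of `a₁, a₂, a₃`. -/
def IsRootsEdge (ends : E → Sym2 V) (a₁ a₂ a₃ : V) (e : E) : Prop :=
  ends e = s(a₁, a₂) ∨ RootEdge.IsRootEdge ends a₁ a₂ a₃ e

/-- **No edge among the roots**: no edge joins two of `a₁, a₂, a₃`. -/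
def NoRootsEdge (ends : E → Sym2 V) (a₁ a₂ a₃ : V) : Prop :=
  ∀ e, ¬ IsRootsEdge ends a₁ a₂ a₃ e

/-- **The class of record with no edge among the roots**: `WReducedMinHA` and `NoRootsEdge`. -/
structure WReducedMinHAZ (ends : E → Sym2 V) (o a₁ a₂ a₃ b : V) : Prop
    extends WReducedMinHA ends o a₁ a₂ a₃ b where
  /-- no edge joins two of the roots -/
  noRootsEdge : NoRootsEdge ends a₁ a₂ a₃

omit [DecidableEq E] in
/-- On the class of record the three roots are pairwise non-adjacent. -/
theorem roots_nonadjacent_of_wredMinHAZ {ends : E → Sym2 V} {o a₁ a₂ a₃ b : V}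
    (h : WReducedMinHAZ ends o a₁ a₂ a₃ b) (e : E) :
    ends e ≠ s(a₁, a₂) ∧ ends e ≠ s(a₁, a₃) ∧ ends e ≠ s(a₂, a₃) :=
  ⟨fun hx => h.noRootsEdge e (Or.inl hx), fun hx => h.noRootsEdge e (Or.inr (Or.inl hx)),
   fun hx => h.noRootsEdge e (Or.inr (Or.inr (Or.inr (Or.inl hx))))⟩

end ClassZ

section ClosureZ

variable (R : Type*) [Field R] [LinearOrder R] [IsStrictOrderedRing R]

/-- **(HCOV) on the class of record with no edge among the roots, at most `N` non-loop edges.** -/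
def HCovWRedMinHAZ_le (N : ℕ) : Prop :=
  ∀ (V E : Type) [Fintype V] [DecidableEq V] [Fintype E] [DecidableEq E]
    (ends : E → Sym2 V), nonLoopCard ends ≤ N → ∀ (p : E → R), IsProbVec p →
    ∀ o a₁ a₂ a₃ b : V, a₁ ≠ a₂ → a₁ ≠ a₃ → a₂ ≠ a₃ → o ≠ a₁ → o ≠ a₂ → o ≠ a₃ → o ≠ b →
      b ≠ a₁ → b ≠ a₂ → b ≠ a₃ → WReducedMinHAZ ends o a₁ a₂ a₃ b → HCov p ends o a₁ a₂ a₃ b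

/-- **(HCOV) on the class of record with no edge among the roots.** -/
def HCovWRedMinHAZ_all : Prop :=
  ∀ (V E : Type) [Fintype V] [DecidableEq V] [Fintype E] [DecidableEq E]
    (ends : E → Sym2 V) (p : E → R), IsProbVec p →
    ∀ o a₁ a₂ a₃ b : V, a₁ ≠ a₂ → a₁ ≠ a₃ → a₂ ≠ a₃ → o ≠ a₁ → o ≠ a₂ → o ≠ a₃ → o ≠ b →
      b ≠ a₁ → b ≠ a₂ → b ≠ a₃ → WReducedMinHAZ ends o a₁ a₂ a₃ b → HCov p ends o a₁ a₂ a₃ b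

/-- **(HCOV) on the class of record with no edge among the roots, at interior weights.** -/
def HCovWRedMinHAZ_int_all : Prop :=
  ∀ (V E : Type) [Fintype V] [DecidableEq V] [Fintype E] [DecidableEq E]
    (ends : E → Sym2 V) (p : E → R), IsIntVec p →
    ∀ o a₁ a₂ a₃ b : V, a₁ ≠ a₂ → a₁ ≠ a₃ → a₂ ≠ a₃ → o ≠ a₁ → o ≠ a₂ → o ≠ a₃ → o ≠ b →
      b ≠ a₁ → b ≠ a₂ → b ≠ a₃ → WReducedMinHAZ ends o a₁ a₂ a₃ b → HCov p ends o a₁ a₂ a₃ b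

end ClosureZ

section MainZ

variable {R : Type*} [Field R] [LinearOrder R] [IsStrictOrderedRing R]

/-- **The reduction to the class of record with no root edge at `a₃`**, size-bounded: strong
induction on `nonLoopCard` over all graphs; at each size the bounded residual theorem
`HCov_of_HCovWRedT_le` is fed the `WReducedT` instances, on which an edge among the roots is
looped (one non-loop edge fewer — the induction hypothesis), the star, hub and active-vertex
class theorems apply, or the instance is in `WReducedMinHAZ`. -/
theorem HCov_of_HCovWRedMinHAZ_le (N : ℕ) (hZ : HCovWRedMinHAZ_le R N) (n : ℕ) :
    n ≤ N → ∀ (V E : Type) [Fintype V] [DecidableEq V] [Fintype E] [DecidableEq E]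
      (ends : E → Sym2 V), nonLoopCard ends ≤ n → ∀ (p : E → R), IsProbVec p →
      ∀ o a₁ a₂ a₃ b : V, a₁ ≠ a₂ → a₁ ≠ a₃ → a₂ ≠ a₃ → o ≠ a₁ → o ≠ a₂ → o ≠ a₃ → o ≠ b →
        b ≠ a₁ → b ≠ a₂ → b ≠ a₃ → HCov p ends o a₁ a₂ a₃ b := by
  induction n using Nat.strong_induction_on with
  | _ n ih =>
  intro hnN
  refine HCov_of_HCovWRedT_le n ?_
  intro V E _ _ _ _ ends hle p hp o a₁ a₂ a₃ b h12 h13 h23 ho1 ho2 ho3 hob hb1 hb2 hb3 hT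
  -- an edge among the roots: loop it, one non-loop edge fewer
  by_cases hZe : ∃ e, IsRootsEdge ends a₁ a₂ a₃ e
  · obtain ⟨e, he⟩ := hZe
    rcases he with he | he
    · have hlt : nonLoopCard (Function.update ends e s(a₁, a₁)) < n :=
        lt_of_lt_of_le (nonLoopCard_update_loop_lt ends
          (by rw [he, Sym2.mk_isDiag_iff]; exact h12) a₁) hle
      exact RootPair.HCov_of_loop_of_rootPair p hp he o a₃ b
        (ih _ hlt (le_trans hlt.le hnN) V E _ le_rfl p hp o a₁ a₂ a₃ b h12 h13 h23 ho1 ho2 ho3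
          hob hb1 hb2 hb3)
    · have hlt : nonLoopCard (Function.update ends e s(a₃, a₃)) < n :=
        lt_of_lt_of_le (nonLoopCard_update_loop_lt ends (not_isDiag_of_isRootEdge h13 h23 he) a₃)
          hle
      exact HCov_of_loop_of_isRootEdge he p hp
        (ih _ hlt (le_trans hlt.le hnN) V E _ le_rfl p hp o a₁ a₂ a₃ b h12 h13 h23 ho1 ho2 ho3
          hob hb1 hb2 hb3)
  -- the class theorems on `(ends, marks)`
  have hMin : WReducedMin ends o a₁ a₂ a₃ b := wredT_iff_wredMin.1 hT
  by_cases hO : OToMarks ends o a₁ a₂ b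
  · exact HCov_of_oToMarks hMin.simple hO ho1 ho2 ho3 hob h12 hb1 hb2 p hp
  by_cases hBs : OToMarks ends b a₁ a₂ o
  · exact HCov_of_bToMarks hMin.simple hBs hb1 hb2 hb3 hob h12 ho1 ho2 p hp
  by_cases hOA : OTwoToMarks ends o a₃ b
  · exact HCov_of_oA3BToMarks hMin.simple hOA ho1 ho2 ho3 hob h13 hb1 hb3 p hp
  by_cases hH : PoleHubToMarks ends o a₁ a₂ a₃ b
  · exact HCov_of_poleHubToMarks hMin.simple hH ho1 ho2 ho3 hob h12 h13 hb1.symm h23 hb2.symm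
      hb3.symm p hp
  by_cases hA : OneActiveUnmarked ends o a₁ a₂ a₃ b
  · exact HCov_of_oneActiveUnmarked hA p hp
  -- the class of record with no edge among the roots
  push Not at hZe
  exact hZ V E ends (le_trans hle hnN) p hp o a₁ a₂ a₃ b h12 h13 h23 ho1 ho2 ho3 hob hb1 hb2 hb3
    ⟨⟨⟨⟨hMin, hO, hBs, hOA⟩, hH⟩, hA⟩, hZe⟩

omit [IsStrictOrderedRing R] in
/-- The closure gives every bound. -/
theorem HCovWRedMinHAZ_le_of_all (h : HCovWRedMinHAZ_all R) (N : ℕ) : HCovWRedMinHAZ_le R N :=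
  fun V E _ _ _ _ ends _ p hp o a₁ a₂ a₃ b h12 h13 h23 ho1 ho2 ho3 hob hb1 hb2 hb3 hred =>
    h V E ends p hp o a₁ a₂ a₃ b h12 h13 h23 ho1 ho2 ho3 hob hb1 hb2 hb3 hred

/-- **THE CLASS OF RECORD WITH NO EDGE AMONG THE ROOTS**: (HCOV) for every finite weighted
graph with five distinct marks follows from (HCOV) on `WReducedMinHAZ`. -/
theorem HCov_all_of_HCovWRedMinHAZ_all (hZ : HCovWRedMinHAZ_all R) : HCov_all R := by
  intro V E _ _ _ _ ends p hp o a₁ a₂ a₃ b h12 h13 h23 ho1 ho2 ho3 hob hb1 hb2 hb3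
  exact HCov_of_HCovWRedMinHAZ_le _ (HCovWRedMinHAZ_le_of_all hZ _) _ le_rfl V E ends le_rfl p hp
    o a₁ a₂ a₃ b h12 h13 h23 ho1 ho2 ho3 hob hb1 hb2 hb3

/-- The class of record with no edge among the roots is a faithful reduction:
`HCov_all ↔ HCovWRedMinHAZ_all`. -/
theorem HCov_all_iff_HCovWRedMinHAZ_all : HCov_all R ↔ HCovWRedMinHAZ_all R :=
  ⟨fun h V E _ _ _ _ ends p hp o a₁ a₂ a₃ b h12 h13 h23 ho1 ho2 ho3 hob hb1 hb2 hb3 _ =>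
    h V E ends p hp o a₁ a₂ a₃ b h12 h13 h23 ho1 ho2 ho3 hob hb1 hb2 hb3,
   HCov_all_of_HCovWRedMinHAZ_all⟩

/-- The two closures agree: `HCovWRedMinHA_all ↔ HCovWRedMinHAZ_all`. -/
theorem HCovWRedMinHA_all_iff_HCovWRedMinHAZ_all :
    HCovWRedMinHA_all R ↔ HCovWRedMinHAZ_all R := by
  rw [← HCov_all_iff_HCovWRedMinHA_all, ← HCov_all_iff_HCovWRedMinHAZ_all]

/-- The interior closure gives the closure (`HCov_of_int`). -/
theorem HCovWRedMinHAZ_all_of_int (h : HCovWRedMinHAZ_int_all R) : HCovWRedMinHAZ_all R := by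
  intro V E _ _ _ _ ends p hp o a₁ a₂ a₃ b h12 h13 h23 ho1 ho2 ho3 hob hb1 hb2 hb3 hred
  exact HCov_of_int ends o a₁ a₂ a₃ b
    (fun q hq => h V E ends q hq o a₁ a₂ a₃ b h12 h13 h23 ho1 ho2 ho3 hob hb1 hb2 hb3 hred) p hp

/-- The two closures agree. -/
theorem HCovWRedMinHAZ_all_iff_int : HCovWRedMinHAZ_all R ↔ HCovWRedMinHAZ_int_all R :=
  ⟨fun h V E _ _ _ _ ends p hp o a₁ a₂ a₃ b h12 h13 h23 ho1 ho2 ho3 hob hb1 hb2 hb3 hred =>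
      h V E ends p hp.isProbVec o a₁ a₂ a₃ b h12 h13 h23 ho1 ho2 ho3 hob hb1 hb2 hb3 hred,
    HCovWRedMinHAZ_all_of_int⟩

/-- **THE CRUX ON THE CLASS OF RECORD WITH NO EDGE AMONG THE ROOTS, AT INTERIOR WEIGHTS**:
`HCov_all ↔ HCovWRedMinHAZ_int_all`. -/
theorem HCov_all_iff_HCovWRedMinHAZ_int_all : HCov_all R ↔ HCovWRedMinHAZ_int_all R :=
  HCov_all_iff_HCovWRedMinHAZ_all.trans HCovWRedMinHAZ_all_iff_int

end MainZ

section Real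

/-- **THE STATEMENT OF RECORD**: the crux over `ℝ` is (HCOV) on the class of record in which no
edge joins two roots, at rational weights in `(0, 1)^E`. -/
theorem HCov_all_real_iff_HCovWRedMinHAZ_int_all_rat :
    HCov_all ℝ ↔ HCovWRedMinHAZ_int_all ℚ :=
  HCov_all_real_iff_rat.trans (HCov_all_iff_HCovWRedMinHAZ_int_all (R := ℚ))

end Real

end WRed

end Summit.Ventures.PercRepro2
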